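import Mathlib
import HarnessLib
import Summits.NavierStokesRegularity.NavierStokesRegularity.Theses.RellichScar
import Literature.Analysis.FluidPDE.SuitableWeak
import Literature.Analysis.FluidPDE.SelfSimilar
import Literature.Analysis.FluidPDE.LocalTypeI
import Literature.Analysis.FluidPDE.ESSLocalHolderNoConcentration
import Summits.NavierStokesRegularity.NavierStokesRegularity.Theorems.RellichScarNoMildScar

/-!
# Skeleton — crux `ApexLocalisation` (stmt-NavierStokesRegularity-11719), line `Sketch`
# (= idea `calm-cone-carleman`, half-space case), lead a2

`ApexLocalisation_of` proves `Summit.NavierStokesRegularity.NavierStokesRegularity.Theses.RellichScar.ApexLocalisation`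
from the registered stubs below.  The line: a rate-Type-I slab profile (`𝐈 < ⊤`) singular at the origin which is
apex-CALM (`‖u(t,x)‖ ≤ K/(‖x‖ + √(−t))`) and scar-FAINT (`‖x‖‖u(t,x)‖ → 0` parabolically at the origin) on a whole open
half-space `{⟪x, e⟫ > 0}` through the origin does not exist (`stub_halfspaceLiouville`, the half-space case of the card's
`TracelessConeLiouville`; ESS 2003 backward uniqueness across half-spaces, PROVED in the tree, replaces the cone Carleman
estimate of Li–Šverák).  Its proof is the ESS §3 routine of the landed `RellichScarNoMildScar*` files, one stub per step:

* S1 `stub_halfspaceZoomLimit` — blow-up at the origin in the rate class; rate / calm / faint pass to the a.e. limit;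
* S2 `stub_halfspaceFarFieldCurl` — `farField_curl_eq_zero` with the exterior of a ball replaced by any open set
  containing a translated half-space (backward uniqueness `Carleman.backwardUniqueness_uncurried_c12`);
* S3 `stub_halfspaceFarFieldRepresentative` — smooth far-field representative on the half-space and `curl = 0` there;
* S4 `stub_halfspaceStripLiouville` — unique continuation on strips + bounded div–curl Liouville + Morrey bound `A ≤ 𝐈`;
* S5 `stub_halfspaceLiouville` — K1, the composition of S1, S3, S4;
* S6 `stub_calmHalfspaceSelection` — THE BET: an origin-singular rate profile yields an apex profile or a calm–faint one.
-/

noncomputable section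

set_option linter.dupNamespace false

namespace Summit.NavierStokesRegularity.NavierStokesRegularity.Theorems.RellichScarApexLocalisation

open MeasureTheory Set Function Metric Filter Topology TopologicalSpace
open scoped ENNReal NNReal InnerProductSpace RealInnerProductSpace
open Literature.Analysis Literature.Analysis.FluidPDE

local notation "E³" => EuclideanSpace ℝ (Fin 3)

/-- The open backward slab `(-∞, 0) × ℝ³` (time first). -/
local notation "𝕊" => Literature.Analysis.FluidPDE.slab (EuclideanSpace ℝ (Fin 3)) (Set.Iio (0 : ℝ)) isOpen_Iio

/-! ### S1 — blow-up at the origin in the rate class -/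

/-- **S1 (stub_halfspaceZoomLimit).** Blow-up at the space–time origin of a rate-Type-I slab profile with `𝐈 < ⊤`,
singular origin, calm and faint on the half-space `{⟪x, e⟫ > 0}`: along dyadic scales the zooms `λ u(λ² s, λ y)`
subconverge in `L³(Q(0,R))` (ENGINE `slab_typeI_compactness`) to a suitable weak slab solution `(w, π, H)` with
`𝐈 < ⊤`, singular origin (`zoom_isBackwardSingularPoint`), and the rate, the calm bound and the LIMIT of the faint
bound (`‖y‖‖w(s,y)‖ ≤ ε` on `{⟪y,e⟫ > 0, −η(ε)‖y‖² < s < 0}`) almost everywhere (template: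
`RellichScarNoMildScar.exists_blowup_limit_apex`). [cite: AlbrittonBarker2019, Lemma 2.2, Prop. 2.3 and §3] -/
theorem stub_halfspaceZoomLimit :
    ∀ (C K : ℝ) (e : E³) (u : ℝ → E³ → E³) (p : ℝ → E³ → ℝ) (G : ℝ → E³ → E³ →L[ℝ] E³),
      IsSuitableWeakSolutionOn 𝕊 1 0 u p → HasWeakSpatialGradientOn 𝕊 u G →
      typeIBound (Iio (0 : ℝ) ×ˢ univ) u p G < ⊤ → HasTypeITimeDecay C u → IsBackwardSingularPoint u 0 →
      (∀ t : ℝ, t < 0 → ∀ x : E³, 0 < ⟪x, e⟫ → ‖u t x‖ ≤ K / (‖x‖ + Real.sqrt (-t))) →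
      (∀ ε : ℝ, 0 < ε → ∃ δ : ℝ, 0 < δ ∧ ∃ η : ℝ, 0 < η ∧ ∀ x : E³, 0 < ⟪x, e⟫ → ‖x‖ < δ →
        ∀ t : ℝ, -η * ‖x‖ ^ 2 < t → t < 0 → ‖x‖ * ‖u t x‖ ≤ ε) →
      ∃ (w : ℝ → E³ → E³) (π : ℝ → E³ → ℝ) (H : ℝ → E³ → E³ →L[ℝ] E³),
        IsSuitableWeakSolutionOn 𝕊 1 0 w π ∧ HasWeakSpatialGradientOn 𝕊 w H ∧
        typeIBound (Iio (0 : ℝ) ×ˢ univ) w π H < ⊤ ∧ IsBackwardSingularPoint w 0 ∧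
        (∀ᵐ z ∂(volume.restrict (Iio (0 : ℝ) ×ˢ (univ : Set E³))), ‖w z.1 z.2‖ ≤ C / Real.sqrt (-z.1)) ∧
        (∀ᵐ z ∂(volume.restrict (Iio (0 : ℝ) ×ˢ (univ : Set E³))),
          0 < ⟪z.2, e⟫ → ‖w z.1 z.2‖ ≤ K / (‖z.2‖ + Real.sqrt (-z.1))) ∧
        (∀ ε : ℝ, 0 < ε → ∃ η : ℝ, 0 < η ∧ ∀ᵐ z ∂(volume.restrict (Iio (0 : ℝ) ×ˢ (univ : Set E³))),
          0 < ⟪z.2, e⟫ → -η * ‖z.2‖ ^ 2 < z.1 → ‖z.2‖ * ‖w z.1 z.2‖ ≤ ε) := by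
  sorry

/-! ### S2 — far-field vorticity vanishes across a translated half-space -/

/-- **S2 (stub_halfspaceFarFieldCurl).** The tree's `farField_curl_eq_zero` (ESS 2003, §3 (3.31)–(3.32)) with the
exterior of a ball replaced by an arbitrary open set `S` containing the translated half-space `x₀ + {⟪y, e⟫ > 0}`:
if `U` is a smooth-in-space representative on `]-1,0[ × S` of a field `w` vanishing weakly at the top, solving
Navier–Stokes there with `‖D_xⁿU‖ ≤ K` (`n ≤ 3`), then `curl U = 0` on `]-1,0[ × {⟪x, e⟫ > ⟪x₀, e⟫}` (backward
uniqueness across the half-space, `Carleman.backwardUniqueness_uncurried_c12`, with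
`Carleman.uniqueContinuation_uncurried_c12` as its unique-continuation input; verbatim template, only `hx₀S` changes).
[cite: EscauriazaSereginSverak2003, §3 (3.31)-(3.32) and Thm. 5.1] -/
theorem stub_halfspaceFarFieldCurl :
    ∀ (S : Set E³) (hS : IsOpen S) (x₀ e : E³), ‖e‖ = 1 → (∀ y : E³, 0 < ⟪y, e⟫ → x₀ + y ∈ S) →
      ∀ (w U : ℝ → E³ → E³) (π : ℝ → E³ → ℝ) (K : ℝ),
      (∀ φ : E³ → E³, ContDiff ℝ (⊤ : ℕ∞) φ → HasCompactSupport φ → ∀ ε : ℝ, 0 < ε →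
        ∃ s₀ : ℝ, s₀ < 0 ∧ ∀ᵐ s ∂(volume.restrict (Ioo s₀ 0)), |∫ y, ⟪w s y, φ y⟫| ≤ ε) →
      uncurry U =ᵐ[volume.restrict (Ioo (-1 : ℝ) 0 ×ˢ S)] uncurry w →
      IsDistributionalNSSolutionOn ⟨Ioo (-1 : ℝ) 0 ×ˢ S, isOpen_Ioo.prod hS⟩ 1 0 U π →
      (∀ t ∈ Ioo (-1 : ℝ) 0, ContDiffOn ℝ 4 (U t) S) →
      (∀ n ≤ 4, ContinuousOn (fun z : ℝ × E³ => iteratedFDeriv ℝ n (U z.1) z.2) (Ioo (-1 : ℝ) 0 ×ˢ S)) →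
      (∀ n ≤ 3, ∀ z ∈ Ioo (-1 : ℝ) 0 ×ˢ S, ‖iteratedFDeriv ℝ n (U z.1) z.2‖ ≤ K) →
      ∀ z ∈ Ioo (-1 : ℝ) 0 ×ˢ {x : E³ | ⟪x₀, e⟫ < ⟪x, e⟫}, curl (U z.1) z.2 = 0 := by
  sorry

/-! ### S3 — the far-field representative on a half-space -/

/-- **S3 (stub_halfspaceFarFieldRepresentative).** If `(w, π)` is a suitable weak slab solution with weak gradient
`H`, `𝐈 < ⊤`, `|w| ≤ 1` a.e. on `]-2,0[ × {⟪x,e⟫ > R₀}` and `w` is uniformly small near the top there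
(`∀ ε, ∃ s₀ < 0, |w| ≤ ε` a.e. on `]s₀,0[ × {⟪x,e⟫ > R₀}`), then on `Ω = ]-1,0[ × {⟪x,e⟫ > R₀ + 1}` the field `w` has
a jointly continuous representative `Uf`, smooth in space with jointly continuous spatial derivatives and
`‖D_xⁿUf‖ ≤ K` (`n ≤ 3`), solving Navier–Stokes on `Ω` with the pressure `π` (Serrin's theory through
`exists_smooth_representative_of_locally_bounded_gauge` in the per-cylinder pressure gauge; template
`RellichScarNoMildScar.apex_farField_representative`), and the CUT-OFF field `w·1_{⟪x,e⟫ > R₀}` (equal to `Uf` a.e. on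
`Ω`) has slices vanishing weakly at the top (`|∫⟪w 1_{⟪·,e⟫>R₀}(s), φ⟫| ≤ ε‖φ‖₁`). These are exactly the inputs of S2.
[cite: EscauriazaSereginSverak2003, §3 (3.26)-(3.30)] [cite: LemarieRieusset2016, proof of Thm. 15.4, Step 2] -/
theorem stub_halfspaceFarFieldRepresentative :
    ∀ (e : E³), ‖e‖ = 1 → ∀ (R₀ : ℝ), 0 < R₀ →
      ∀ (w : ℝ → E³ → E³) (π : ℝ → E³ → ℝ) (H : ℝ → E³ → E³ →L[ℝ] E³),
      IsSuitableWeakSolutionOn 𝕊 1 0 w π → HasWeakSpatialGradientOn 𝕊 w H →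
      typeIBound (Iio (0 : ℝ) ×ˢ univ) w π H < ⊤ →
      (∀ᵐ z ∂(volume.restrict (Ioo (-2 : ℝ) 0 ×ˢ {x : E³ | R₀ < ⟪x, e⟫})), ‖w z.1 z.2‖ ≤ 1) →
      (∀ ε : ℝ, 0 < ε → ∃ s₀ : ℝ, s₀ < 0 ∧
        ∀ᵐ z ∂(volume.restrict (Ioo s₀ 0 ×ˢ {x : E³ | R₀ < ⟪x, e⟫})), ‖w z.1 z.2‖ ≤ ε) →
      ∃ (Uf : ℝ → E³ → E³) (K : ℝ),
        uncurry Uf =ᵐ[volume.restrict (Ioo (-1 : ℝ) 0 ×ˢ {x : E³ | R₀ + 1 < ⟪x, e⟫})] uncurry w ∧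
        ContinuousOn (uncurry Uf) (Ioo (-1 : ℝ) 0 ×ˢ {x : E³ | R₀ + 1 < ⟪x, e⟫}) ∧
        (∀ φ : E³ → E³, ContDiff ℝ (⊤ : ℕ∞) φ → HasCompactSupport φ → ∀ ε : ℝ, 0 < ε →
          ∃ s₀ : ℝ, s₀ < 0 ∧ ∀ᵐ s ∂(volume.restrict (Ioo s₀ 0)),
            |∫ y, ⟪(if R₀ < ⟪y, e⟫ then w s y else 0), φ y⟫| ≤ ε) ∧
        (uncurry Uf =ᵐ[volume.restrict (Ioo (-1 : ℝ) 0 ×ˢ {x : E³ | R₀ + 1 < ⟪x, e⟫})]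
          fun z => if R₀ < ⟪z.2, e⟫ then w z.1 z.2 else 0) ∧
        IsDistributionalNSSolutionOn ⟨Ioo (-1 : ℝ) 0 ×ˢ {x : E³ | R₀ + 1 < ⟪x, e⟫},
          isOpen_Ioo.prod (isOpen_lt continuous_const (continuous_id.inner continuous_const))⟩ 1 0 Uf π ∧
        (∀ t ∈ Ioo (-1 : ℝ) 0, ContDiffOn ℝ 4 (Uf t) {x : E³ | R₀ + 1 < ⟪x, e⟫}) ∧
        (∀ n ≤ 4, ContinuousOn (fun z : ℝ × E³ => iteratedFDeriv ℝ n (Uf z.1) z.2)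
          (Ioo (-1 : ℝ) 0 ×ˢ {x : E³ | R₀ + 1 < ⟪x, e⟫})) ∧
        (∀ n ≤ 3, ∀ z ∈ Ioo (-1 : ℝ) 0 ×ˢ {x : E³ | R₀ + 1 < ⟪x, e⟫}, ‖iteratedFDeriv ℝ n (Uf z.1) z.2‖ ≤ K) := by
  sorry

/-! ### S4 — strips below the final time -/

/-- **S4 (stub_halfspaceStripLiouville).** Let `(w, π)` be a suitable weak slab solution with weak gradient `H` and
`𝐈 < ⊤`, let `Uf` be its far-field representative on `]-1,0[ × {⟪x,e⟫ > R₁}` with `curl Uf = 0` for `⟪x,e⟫ > R₁ + 1`,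
and let `]a,b[ × ℝ³`, `b ≤ 0`, be a strip with `|w| ≤ L` a.e. on `]a − 4ρ², b[ × ℝ³`. Then `w(s,·) = 0` a.e. for a.e.
`s ∈ ]a,b[`: the smooth representative on the strip has vorticity of class `C¹₂` with the Carleman inequality,
vanishing on the far half-space, hence identically (`Carleman.uniqueContinuation_uncurried_c12` from a far centre
with a radius covering the target point); the slice is a bounded irrotational incompressible field, hence constant
(`eq_of_curl_eq_zero_of_isDivFree_of_bounded`), and the Morrey bound `∫_{B(0,η)} |w(s)|² ≤ η 𝐈`
(`ae_lintegral_ball_sq_le`) forces the constant to vanish (template `RellichScarNoMildScar.apex_strip_velocity_ae_zero`).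
[cite: EscauriazaSereginSverak2003, §3 after (3.32) and Thm. 4.1] -/
theorem stub_halfspaceStripLiouville :
    ∀ (e : E³), ‖e‖ = 1 → ∀ (R₁ : ℝ), 0 < R₁ →
      ∀ (w : ℝ → E³ → E³) (π : ℝ → E³ → ℝ) (H : ℝ → E³ → E³ →L[ℝ] E³) (Uf : ℝ → E³ → E³),
      IsSuitableWeakSolutionOn 𝕊 1 0 w π → HasWeakSpatialGradientOn 𝕊 w H →
      typeIBound (Iio (0 : ℝ) ×ˢ univ) w π H < ⊤ →
      uncurry Uf =ᵐ[volume.restrict (Ioo (-1 : ℝ) 0 ×ˢ {x : E³ | R₁ < ⟪x, e⟫})] uncurry w →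
      ContinuousOn (uncurry Uf) (Ioo (-1 : ℝ) 0 ×ˢ {x : E³ | R₁ < ⟪x, e⟫}) →
      (∀ z ∈ Ioo (-1 : ℝ) 0 ×ˢ {x : E³ | R₁ + 1 < ⟪x, e⟫}, curl (Uf z.1) z.2 = 0) →
      ∀ (a b ρ L : ℝ), 0 < ρ → -1 ≤ a - 4 * ρ ^ 2 → b ≤ 0 →
      (∀ᵐ z ∂(volume.restrict (Ioo (a - 4 * ρ ^ 2) b ×ˢ (univ : Set E³))), ‖w z.1 z.2‖ ≤ L) →
      ∀ᵐ s ∂(volume.restrict (Ioo a b)), w s =ᵐ[volume] 0 := by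
  sorry

/-! ### S5 — K1: the half-space Liouville theorem (composition of S1, S3, S4) -/

/-- **S5 (stub_halfspaceLiouville) — K1, `TracelessConeLiouville` in the half-space case.** A suitable weak solution
of Navier–Stokes on the backward slab with a weak gradient, `𝐈 < ⊤` and the Type-I RATE `‖u(t,x)‖ ≤ C/√(−t)`, which
on an open half-space `{⟪x,e⟫ > 0}` through the origin is apex-CALM (`‖u(t,x)‖ ≤ K/(‖x‖ + √(−t))`) and scar-FAINT
(`‖x‖‖u(t,x)‖ ≤ ε` for `⟪x,e⟫ > 0`, `‖x‖ < δ`, `−η‖x‖² < t < 0`), is NOT singular at the origin.  Proof: the blow-up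
limit at the origin (S1) is `≤ 1` and uniformly small near the top on a far half-space, so its far-field vorticity
vanishes there (S3), hence its slices vanish on every strip below the final time (S4, the rate bounding the strips), so
the limit vanishes on `Q(0, 1/2)` — but it is singular at the origin. [cite: EscauriazaSereginSverak2003, Thm. 1.4 and §3] -/
theorem stub_halfspaceLiouville :
    ∀ (C K : ℝ) (e : E³), ‖e‖ = 1 →
      ∀ (u : ℝ → E³ → E³) (p : ℝ → E³ → ℝ) (G : ℝ → E³ → E³ →L[ℝ] E³),
      IsSuitableWeakSolutionOn 𝕊 1 0 u p → HasWeakSpatialGradientOn 𝕊 u G →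
      typeIBound (Iio (0 : ℝ) ×ˢ univ) u p G < ⊤ → HasTypeITimeDecay C u →
      (∀ t : ℝ, t < 0 → ∀ x : E³, 0 < ⟪x, e⟫ → ‖u t x‖ ≤ K / (‖x‖ + Real.sqrt (-t))) →
      (∀ ε : ℝ, 0 < ε → ∃ δ : ℝ, 0 < δ ∧ ∃ η : ℝ, 0 < η ∧ ∀ x : E³, 0 < ⟪x, e⟫ → ‖x‖ < δ →
        ∀ t : ℝ, -η * ‖x‖ ^ 2 < t → t < 0 → ‖x‖ * ‖u t x‖ ≤ ε) →
      ¬ IsBackwardSingularPoint u 0 := by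
  intro C K e he u p G hsw hwg hI hrate hcalm hfaint hsing
  -- ## S1: blow-up at the origin
  obtain ⟨w, π, H, hsww, hH, hIw, hsingw, hratew, hcalmw, hfaintw⟩ :=
    stub_halfspaceZoomLimit C K e u p G hsw hwg hI hrate hsing hcalm hfaint
  have hSo : ∀ R : ℝ, IsOpen {x : E³ | R < ⟪x, e⟫} := fun R =>
    isOpen_lt continuous_const (continuous_id.inner continuous_const)
  have hSm : ∀ R : ℝ, MeasurableSet {x : E³ | R < ⟪x, e⟫} := fun R => (hSo R).measurableSet
  have hinner : ∀ x : E³, ⟪x, e⟫ ≤ ‖x‖ := fun x => by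
    have h := real_inner_le_norm x e
    rwa [he, mul_one] at h
  -- ## the far half-space `{⟪x, e⟫ > R₀}`: `|w| ≤ 1` and uniform smallness near the top
  set R₀ : ℝ := max K 1 with hR₀def
  have hR₀ : 0 < R₀ := lt_of_lt_of_le one_pos (le_max_right _ _)
  have hfar : ∀ᵐ z ∂(volume.restrict (Ioo (-2 : ℝ) 0 ×ˢ {x : E³ | R₀ < ⟪x, e⟫})), ‖w z.1 z.2‖ ≤ 1 := by
    have hsub : Ioo (-2 : ℝ) 0 ×ˢ {x : E³ | R₀ < ⟪x, e⟫} ⊆ Iio (0 : ℝ) ×ˢ (univ : Set E³) :=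
      prod_mono Ioo_subset_Iio_self (subset_univ _)
    filter_upwards [ae_restrict_of_ae_restrict_of_subset hsub hcalmw,
      ae_restrict_mem (measurableSet_Ioo.prod (hSm R₀))] with z hz hzmem
    have hxe : R₀ < ⟪z.2, e⟫ := hzmem.2
    have hpos : 0 < ⟪z.2, e⟫ := hR₀.trans hxe
    have hxn : R₀ < ‖z.2‖ := lt_of_lt_of_le hxe (hinner z.2)
    have ht : z.1 < 0 := hzmem.1.2
    have hs : 0 < Real.sqrt (-z.1) := Real.sqrt_pos.2 (by linarith)
    refine (hz hpos).trans ?_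
    rcases le_or_gt K 0 with hK | hK
    · exact (div_nonpos_of_nonpos_of_nonneg hK (by positivity)).trans zero_le_one
    · rw [div_le_one (by positivity)]
      have : K ≤ R₀ := le_max_left _ _
      linarith
  have hsmall : ∀ ε : ℝ, 0 < ε → ∃ s₀ : ℝ, s₀ < 0 ∧
      ∀ᵐ z ∂(volume.restrict (Ioo s₀ 0 ×ˢ {x : E³ | R₀ < ⟪x, e⟫})), ‖w z.1 z.2‖ ≤ ε := by
    intro ε hε
    obtain ⟨η, hη, hfw⟩ := hfaintw (ε * R₀) (by positivity)
    refine ⟨-(η * R₀ ^ 2), by rw [neg_lt_zero]; positivity, ?_⟩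
    have hsub : Ioo (-(η * R₀ ^ 2)) 0 ×ˢ {x : E³ | R₀ < ⟪x, e⟫} ⊆ Iio (0 : ℝ) ×ˢ (univ : Set E³) :=
      prod_mono Ioo_subset_Iio_self (subset_univ _)
    filter_upwards [ae_restrict_of_ae_restrict_of_subset hsub hfw,
      ae_restrict_mem (measurableSet_Ioo.prod (hSm R₀))] with z hz hzmem
    have hxe : R₀ < ⟪z.2, e⟫ := hzmem.2
    have hpos : 0 < ⟪z.2, e⟫ := hR₀.trans hxe
    have hxn : R₀ < ‖z.2‖ := lt_of_lt_of_le hxe (hinner z.2)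
    have hn0 : 0 < ‖z.2‖ := hR₀.trans hxn
    have htime : -η * ‖z.2‖ ^ 2 < z.1 := by
      have h1 : -(η * R₀ ^ 2) < z.1 := hzmem.1.1
      have h2 : R₀ ^ 2 < ‖z.2‖ ^ 2 := by nlinarith
      nlinarith
    have key : ‖z.2‖ * ‖w z.1 z.2‖ ≤ ε * R₀ := hz hpos htime
    by_contra hcon
    push Not at hcon
    have : ε * R₀ < ‖z.2‖ * ‖w z.1 z.2‖ := by nlinarith
    linarith
  -- ## S3: the far-field representative; S2: its vorticity vanishes on the far half-space
  obtain ⟨Uf, Kf, hUf, hUfc, htop, hUf', hsol, hU4, hΦ, hKf⟩ :=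
    stub_halfspaceFarFieldRepresentative e he R₀ hR₀ w π H hsww hH hIw hfar hsmall
  set x₀ : E³ := (R₀ + 1) • e with hx₀def
  have hx₀e : ⟪x₀, e⟫ = R₀ + 1 := by
    rw [hx₀def, real_inner_smul_left, real_inner_self_eq_norm_sq, he]; ring
  have hx₀S : ∀ y : E³, 0 < ⟪y, e⟫ → x₀ + y ∈ {x : E³ | R₀ + 1 < ⟪x, e⟫} := by
    intro y hy
    show R₀ + 1 < ⟪x₀ + y, e⟫
    rw [inner_add_left, hx₀e]
    linarith
  have hcurl0 := stub_halfspaceFarFieldCurl {x : E³ | R₀ + 1 < ⟪x, e⟫} (hSo (R₀ + 1)) x₀ e he hx₀S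
    (fun s y => if R₀ < ⟪y, e⟫ then w s y else 0) Uf π Kf htop hUf' hsol hU4 hΦ hKf
  have hcurl : ∀ z ∈ Ioo (-1 : ℝ) 0 ×ˢ {x : E³ | R₀ + 1 + 1 < ⟪x, e⟫}, curl (Uf z.1) z.2 = 0 := by
    rintro z ⟨hz1, hz2⟩
    refine hcurl0 z ⟨hz1, ?_⟩
    show ⟪x₀, e⟫ < ⟪z.2, e⟫
    have hz2' : R₀ + 1 + 1 < ⟪z.2, e⟫ := hz2
    rw [hx₀e]
    linarith
  -- ## S4 on the strips `]-1/3, -1/(n+4)[`, the rate bounding the velocity there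
  have hstrip : ∀ n : ℕ, ∀ᵐ s ∂(volume.restrict (Ioo (-(1 / 3 : ℝ)) (-(1 / ((n : ℝ) + 4))))),
      w s =ᵐ[volume] 0 := by
    intro n
    set b : ℝ := -(1 / ((n : ℝ) + 4)) with hbdef
    have hb : b < 0 := by rw [hbdef, neg_lt_zero]; positivity
    have hbd : ∀ᵐ z ∂(volume.restrict (Ioo (-(1 / 3 : ℝ) - 4 * (1 / 4 : ℝ) ^ 2) b ×ˢ (univ : Set E³))),
        ‖w z.1 z.2‖ ≤ max C 0 / Real.sqrt (-b) := by
      have hsub : Ioo (-(1 / 3 : ℝ) - 4 * (1 / 4 : ℝ) ^ 2) b ×ˢ (univ : Set E³) ⊆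
          Iio (0 : ℝ) ×ˢ (univ : Set E³) := prod_mono (fun t ht => ht.2.trans hb) Subset.rfl
      filter_upwards [ae_restrict_of_ae_restrict_of_subset hsub hratew,
        ae_restrict_mem (measurableSet_Ioo.prod MeasurableSet.univ)] with z hz hzmem
      have ht : z.1 < b := hzmem.1.2
      have hs : 0 < Real.sqrt (-z.1) := Real.sqrt_pos.2 (by linarith)
      have hsb : 0 < Real.sqrt (-b) := Real.sqrt_pos.2 (by linarith)
      calc ‖w z.1 z.2‖ ≤ C / Real.sqrt (-z.1) := hz
        _ ≤ max C 0 / Real.sqrt (-z.1) := div_le_div_of_nonneg_right (le_max_left _ _) hs.le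
        _ ≤ max C 0 / Real.sqrt (-b) :=
            div_le_div_of_nonneg_left (le_max_right _ _) hsb (Real.sqrt_le_sqrt (by linarith))
    exact stub_halfspaceStripLiouville e he (R₀ + 1) (by positivity) w π H Uf hsww hH hIw hUf hUfc
      hcurl (-(1 / 3 : ℝ)) b (1 / 4) (max C 0 / Real.sqrt (-b)) (by norm_num) (by norm_num) hb.le hbd
  -- ## `w(s) = 0` a.e. for a.e. `s ∈ ]-1/3, 0[`
  have hae0 : ∀ᵐ s ∂(volume.restrict (Ioo (-(1 / 3 : ℝ)) 0)), w s =ᵐ[volume] 0 := by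
    have hcov : Ioo (-(1 / 3 : ℝ)) 0 ⊆ ⋃ n : ℕ, Ioo (-(1 / 3 : ℝ)) (-(1 / ((n : ℝ) + 4))) := by
      intro s hs
      obtain ⟨n, hn⟩ := exists_nat_one_div_lt (neg_pos.2 hs.2)
      refine mem_iUnion.2 ⟨n, hs.1, ?_⟩
      have h1 : 1 / ((n : ℝ) + 4) ≤ 1 / ((n : ℝ) + 1) :=
        one_div_le_one_div_of_le (by positivity) (by linarith)
      linarith
    refine ae_restrict_of_ae_restrict_of_subset hcov ?_
    rw [ae_restrict_iUnion_iff]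
    exact hstrip
  -- ## `w = 0` a.e. on `Q(0, 1/2)`: the origin is not singular
  have hQ : parabolicCylinder (1 / 2) (0 : ℝ × E³) = Ioo (-(1 / 4 : ℝ)) 0 ×ˢ ball (0 : E³) (1 / 2) := by
    rw [parabolicCylinder]
    simp only [Prod.fst_zero, Prod.snd_zero, zero_sub]
    norm_num
  have hwmQ : AEStronglyMeasurable (uncurry w)
      (volume.restrict (parabolicCylinder (1 / 2) (0 : ℝ × E³))) :=
    hH.locallyIntegrableOn.aestronglyMeasurable.mono_measure
      (Measure.restrict_mono (parabolicCylinder_subset_slab _ le_rfl) le_rfl)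
  have hzero : ∫⁻ z in parabolicCylinder (1 / 2) (0 : ℝ × E³), ‖w z.1 z.2‖ₑ = 0 := by
    have hf : AEMeasurable (fun z : ℝ × E³ => ‖w z.1 z.2‖ₑ)
        ((volume.restrict (Ioo (-(1 / 4 : ℝ)) 0)).prod (volume.restrict (ball (0 : E³) (1 / 2)))) := by
      rw [Measure.prod_restrict, ← Measure.volume_eq_prod, ← hQ]
      exact hwmQ.enorm
    rw [hQ, Measure.volume_eq_prod, ← Measure.prod_restrict, lintegral_prod _ hf]
    refine (lintegral_congr_ae ?_).trans lintegral_zero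
    filter_upwards [ae_restrict_of_ae_restrict_of_subset (Ioo_subset_Ioo (by norm_num) le_rfl) hae0] with t ht
    refine (lintegral_congr_ae ?_).trans lintegral_zero
    filter_upwards [ae_restrict_of_ae ht] with x hx
    simp [hx]
  have hae : ∀ᵐ z ∂(volume.restrict (parabolicCylinder (1 / 2) (0 : ℝ × E³))),
      uncurry w z = (0 : ℝ × E³ → E³) z := by
    have h := (lintegral_eq_zero_iff' hwmQ.enorm).1 hzero
    filter_upwards [h] with ⟨t, x⟩ hz
    have hz' : ‖w t x‖ₑ = 0 := hz
    simpa using hz'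
  have h0 : eLpNorm (uncurry w) ⊤ (volume.restrict (parabolicCylinder (1 / 2) (0 : ℝ × E³))) = 0 :=
    (eLpNorm_eq_zero_iff hwmQ ENNReal.top_ne_zero).2 hae
  have h := hsingw (1 / 2) (by norm_num)
  rw [h0] at h
  exact ENNReal.zero_ne_top h

/-! ### S6 — THE BET -/

/-- **S6 (stub_calmHalfspaceSelection) — THE BET of the line.** Every origin-singular rate-Type-I slab profile with
`𝐈 < ⊤` yields EITHER an origin-singular apex profile (the crux' conclusion) OR an origin-singular rate profile which
is calm and faint on some open half-space through the origin (which S5 forbids).  Crux-like: implied by the crux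
(first disjunct), (L)-vacuous, irrefutable short of a Type-I blow-up (Disproof §10); the residual "one clean
half-space at some point of the scaling-orbit closure" is the half-space form of the card's (S) + (R'_iso). -/
theorem stub_calmHalfspaceSelection :
    ∀ C : ℝ, (∃ (u : ℝ → E³ → E³) (p : ℝ → E³ → ℝ) (G : ℝ → E³ → E³ →L[ℝ] E³),
        IsSuitableWeakSolutionOn 𝕊 1 0 u p ∧ HasWeakSpatialGradientOn 𝕊 u G ∧
        typeIBound (Set.Iio (0 : ℝ) ×ˢ Set.univ) u p G < ⊤ ∧ HasTypeITimeDecay C u ∧ IsBackwardSingularPoint u 0) →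
      (∃ (C' : ℝ) (u : ℝ → E³ → E³) (p : ℝ → E³ → ℝ) (G : ℝ → E³ → E³ →L[ℝ] E³),
        IsSuitableWeakSolutionOn 𝕊 1 0 u p ∧ HasWeakSpatialGradientOn 𝕊 u G ∧
        typeIBound (Set.Iio (0 : ℝ) ×ˢ Set.univ) u p G < ⊤ ∧ HasTypeIDecay C' u ∧ IsBackwardSingularPoint u 0) ∨
      (∃ (C₁ K : ℝ) (e : E³) (u : ℝ → E³ → E³) (p : ℝ → E³ → ℝ) (G : ℝ → E³ → E³ →L[ℝ] E³),
        ‖e‖ = 1 ∧ IsSuitableWeakSolutionOn 𝕊 1 0 u p ∧ HasWeakSpatialGradientOn 𝕊 u G ∧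
        typeIBound (Set.Iio (0 : ℝ) ×ˢ Set.univ) u p G < ⊤ ∧ HasTypeITimeDecay C₁ u ∧ IsBackwardSingularPoint u 0 ∧
        (∀ t : ℝ, t < 0 → ∀ x : E³, 0 < ⟪x, e⟫ → ‖u t x‖ ≤ K / (‖x‖ + Real.sqrt (-t))) ∧
        (∀ ε : ℝ, 0 < ε → ∃ δ : ℝ, 0 < δ ∧ ∃ η : ℝ, 0 < η ∧ ∀ x : E³, 0 < ⟪x, e⟫ → ‖x‖ < δ →
          ∀ t : ℝ, -η * ‖x‖ ^ 2 < t → t < 0 → ‖x‖ * ‖u t x‖ ≤ ε)) := by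
  sorry

/-! ### The composition -/

/-- **The crux from the stubs**: the bet S6 produces either an apex profile (done) or a calm–faint origin-singular
rate profile, which the half-space Liouville theorem S5 forbids. -/
theorem ApexLocalisation_of :
    Summit.NavierStokesRegularity.NavierStokesRegularity.Theses.RellichScar.ApexLocalisation := by
  intro C h
  rcases stub_calmHalfspaceSelection C h with hapex | ⟨C₁, K, e, u, p, G, he, hsw, hwg, hI, hrate, hsing, hcalm, hfaint⟩
  · exact hapex
  · exact absurd hsing (stub_halfspaceLiouville C₁ K e he u p G hsw hwg hI hrate hcalm hfaint)

end Summit.NavierStokesRegularity.NavierStokesRegularity.Theorems.RellichScarApexLocalisation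

end
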